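import Summits.CriticalPhenomena.PercolationContinuityZ3.Theorems.PercNearOneGluingNoHeavyLowerTailAntipodalR1Adjacent
import HarnessLib

/-!
# ANTI₁: relabelling the edges

Support file for `stmt-CriticalPhenomena-4575` (conjecture ANTI₁ of `KCLUSTER-gen52.md` §3; memo
`prim-gen-kcluster/KCLUSTER-gen78.md`).  No definitions, no named facts, no sorries.  Vocabulary of
`AntipodalR1` (gen 62).

Relabelling the edge index type along an equivalence `e : ι' ≃ ι` (system `ends ∘ e`, colouring `x ∘ e`)
changes nothing: coloured adjacency, clusters, regions, membership in `L` and `R`, and the coloured graphs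
(hence the grade) are invariant (`nbr_comp_equiv`, `clus_comp_equiv`, `region_comp_equiv`,
`mem_lSet_comp_equiv`, `mem_rSet_comp_equiv`, `colGraph_comp_equiv`).  Used to re-bracket glued systems
`Sum.elim … …` (gen 78 reduction files).  [this work]
-/

namespace Summit.CriticalPhenomena.PercolationContinuityZ3.Theorems

namespace AntipodalR1

open Finset Relation SimpleGraph

variable {V ι ι' : Type*}

/-- Coloured adjacency is invariant under relabelling the edges. [this work] -/
theorem nbr_comp_equiv (e : ι' ≃ ι) (ends : ι → Sym2 V) (x : ι → Bool) (col : Bool) :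
    nbr (ends ∘ e) (x ∘ e) col = nbr ends x col := by
  funext u
  ext v
  constructor
  · rintro ⟨i', hi, hends⟩
    exact ⟨e i', hi, hends⟩
  · rintro ⟨i, hi, hends⟩
    refine ⟨e.symm i, ?_, ?_⟩
    · show x (e (e.symm i)) = col
      rw [e.apply_symm_apply]; exact hi
    · show ends (e (e.symm i)) = s(u, v)
      rw [e.apply_symm_apply]; exact hends

/-- Clusters are invariant under relabelling the edges. [this work] -/
theorem clus_comp_equiv (e : ι' ≃ ι) (ends : ι → Sym2 V) (x : ι → Bool) (col : Bool) (a : V) :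
    clus (ends ∘ e) (x ∘ e) col a = clus ends x col a := by
  ext v
  rw [mem_clus, mem_clus, nbr_comp_equiv]

/-- Regions are invariant under relabelling the edges. [this work] -/
theorem region_comp_equiv (e : ι' ≃ ι) (ends : ι → Sym2 V) (x : ι → Bool) (a b : V) :
    region (ends ∘ e) (x ∘ e) a b = region ends x a b := by
  have hfree : (fun u w => w ∈ freeNbr (ends ∘ e) (x ∘ e) a u) =
      fun u w => w ∈ freeNbr ends x a u := by
    funext u w
    apply propext
    show ((∃ i', (ends ∘ e) i' = s(u, w)) ∧ u ∉ clus (ends ∘ e) (x ∘ e) false a ∧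
        w ∉ clus (ends ∘ e) (x ∘ e) false a) ↔
      ((∃ i, ends i = s(u, w)) ∧ u ∉ clus ends x false a ∧ w ∉ clus ends x false a)
    rw [clus_comp_equiv]
    constructor
    · rintro ⟨⟨i', hi⟩, hu, hw⟩
      exact ⟨⟨e i', hi⟩, hu, hw⟩
    · rintro ⟨⟨i, hi⟩, hu, hw⟩
      refine ⟨⟨e.symm i, ?_⟩, hu, hw⟩
      show ends (e (e.symm i)) = s(u, w)
      rw [e.apply_symm_apply]; exact hi
  ext v
  rw [mem_region, mem_region, hfree]

variable [Fintype ι] [DecidableEq ι] [Fintype ι'] [DecidableEq ι']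

/-- Membership in `L` is invariant under relabelling the edges. [this work] -/
theorem mem_lSet_comp_equiv (e : ι' ≃ ι) (ends : ι → Sym2 V) (x : ι → Bool) (a b c : V) :
    x ∘ e ∈ lSet (ends ∘ e) a b c ↔ x ∈ lSet ends a b c := by
  classical
  simp only [lSet, mem_filter, mem_univ, true_and]
  rw [clus_comp_equiv, clus_comp_equiv, region_comp_equiv]

/-- Membership in `R` is invariant under relabelling the edges. [this work] -/
theorem mem_rSet_comp_equiv (e : ι' ≃ ι) (ends : ι → Sym2 V) (x : ι → Bool) (a b c : V) :
    x ∘ e ∈ rSet (ends ∘ e) a b c ↔ x ∈ rSet ends a b c := by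
  classical
  simp only [rSet, mem_filter, mem_univ, true_and]
  rw [clus_comp_equiv, clus_comp_equiv]

omit [Fintype ι] [DecidableEq ι] [Fintype ι'] [DecidableEq ι'] in
/-- The coloured graphs are invariant under relabelling the edges. [this work] -/
theorem colGraph_comp_equiv (e : ι' ≃ ι) (ends : ι → Sym2 V) (x : ι → Bool) (col : Bool) :
    fromEdgeSet {s : Sym2 V | ∃ i', (x ∘ e) i' = col ∧ (ends ∘ e) i' = s} =
      fromEdgeSet {s : Sym2 V | ∃ i, x i = col ∧ ends i = s} := by
  congr 1
  ext s
  constructor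
  · rintro ⟨i', hi, hends⟩
    exact ⟨e i', hi, hends⟩
  · rintro ⟨i, hi, hends⟩
    refine ⟨e.symm i, ?_, ?_⟩
    · show x (e (e.symm i)) = col
      rw [e.apply_symm_apply]; exact hi
    · show ends (e (e.symm i)) = s
      rw [e.apply_symm_apply]; exact hends

end AntipodalR1

end Summit.CriticalPhenomena.PercolationContinuityZ3.Theorems
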